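import Mathlib
import HarnessLib

/-!
# Complex conjugation as `σ : ℂ ≃ₐ[ℚ] ℂ`: `d ≡ −1 (mod N)` and the SIGN of a square class
(route `ManinLocalTwoThree`, crux C2 `ManinOddAtFour` stmt-BirchSwinnertonDyer-22967; cell bsd-f2-manin, C2/C3 LEAD p1 gen 19;
`--supports stmt-BirchSwinnertonDyer-22967`; D5→D6 bridge of E-es-185: the SIGN hypotheses `0 < ∏ D₁ q`, `0 < ∏ D₂ q` of
`KummerDiamondStepTwo.descent_table_of_diamond_classes` come from THEOREM K at complex conjugation (`ϖ(−1) = 0`, MEMO-es §59.5: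
"`ϖ(−1) = 0` … THIS is the sign lever"); here: conjugation IS such a `σ`, it has `d = N − 1`, and `σ(w)/w = sign δ` for `w² = δ ∈ ℚˣ`)

* `exists_algEquiv_eq_conj` — `∃ σ : ℂ ≃ₐ[ℚ] ℂ, ∀ z, σ z = conj z`;
* `conj_exp_two_pi_I_div` — `conj(e^{2πi/N}) = (e^{2πi/N})^{N−1}` (`d ≡ −1`);
* `conj_eq_self_of_sq_eq_pos` / `conj_eq_neg_of_sq_eq_neg` — `w² = δ`, `δ > 0` ⟹ `conj w = w`; `δ < 0` ⟹ `conj w = −w`.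

Elementary; nothing about C2, Manin's conjecture or BSD is proved here.  [folklore]
-/

set_option autoImplicit false
-- lint-debt: the directory name repeats the summit name (sibling precedent `ManinLocalTwoThreeComplexAutExtension.lean`)
set_option linter.dupNamespace false

noncomputable section

open Complex

namespace Summit.BirchSwinnertonDyer.BirchSwinnertonDyer.Theorems.ManinLocalTwoThree.ComplexAut

/-- Complex conjugation is a `ℚ`-algebra automorphism of `ℂ`. [folklore] -/
theorem exists_algEquiv_eq_conj : ∃ σ : ℂ ≃ₐ[ℚ] ℂ, ∀ z : ℂ, σ z = starRingEnd ℂ z :=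
  ⟨Complex.conjAe.restrictScalars ℚ, fun _ => rfl⟩

/-- `conj(e^{2πi/N}) = (e^{2πi/N})^{N−1}`: complex conjugation acts on `ζ_N` as `d = N − 1 ≡ −1`. [folklore] -/
theorem conj_exp_two_pi_I_div (N : ℕ) (hN : N ≠ 0) :
    starRingEnd ℂ (exp (2 * Real.pi * I / N)) = exp (2 * Real.pi * I / N) ^ (N - 1) := by
  have hζN : exp (2 * Real.pi * I / N) ^ N = 1 := (Complex.isPrimitiveRoot_exp N hN).pow_eq_one
  have hne : exp (2 * Real.pi * I / N) ≠ 0 := exp_ne_zero _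
  -- `conj ζ = ζ⁻¹`
  have hconj : starRingEnd ℂ (exp (2 * Real.pi * I / N)) = (exp (2 * Real.pi * I / N))⁻¹ := by
    rw [← exp_conj, ← exp_neg]
    congr 1
    simp only [map_div₀, map_mul, map_ofNat, conj_ofReal, conj_I, map_natCast]
    ring
  rw [hconj, eq_comm, ← mul_eq_one_iff_eq_inv₀ hne, ← pow_succ, Nat.sub_add_cancel (Nat.pos_of_ne_zero hN), hζN]

/-- If `w² = δ` with `δ ∈ ℚ`, `0 < δ`, then `w` is real: `conj w = w`. [folklore] -/
theorem conj_eq_self_of_sq_eq_pos {δ : ℚ} (hδ : 0 < δ) {w : ℂ} (hw : w ^ 2 = (δ : ℂ)) : starRingEnd ℂ w = w := by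
  have hre : (w ^ 2).re = (δ : ℂ).re := by rw [hw]
  have him : (w ^ 2).im = (δ : ℂ).im := by rw [hw]
  simp only [sq, mul_re, mul_im, ratCast_re, ratCast_im] at hre him
  -- `w.re * w.im = 0` and `w.re² − w.im² = δ > 0` force `w.im = 0`
  have hδR : (0 : ℝ) < δ := by exact_mod_cast hδ
  have him0 : w.im = 0 := by
    by_contra h
    have hre0 : w.re = 0 := by
      have : 2 * (w.re * w.im) = 0 := by linarith
      rcases mul_eq_zero.mp this with h2 | h2
      · norm_num at h2
      · exact (mul_eq_zero.mp h2).resolve_right h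
    rw [hre0] at hre
    nlinarith [sq_nonneg w.im]
  exact conj_eq_iff_im.mpr him0

/-- If `w² = δ` with `δ ∈ ℚ`, `δ < 0`, then `w` is purely imaginary: `conj w = −w`. [folklore] -/
theorem conj_eq_neg_of_sq_eq_neg {δ : ℚ} (hδ : δ < 0) {w : ℂ} (hw : w ^ 2 = (δ : ℂ)) : starRingEnd ℂ w = -w := by
  have hre : (w ^ 2).re = (δ : ℂ).re := by rw [hw]
  have him : (w ^ 2).im = (δ : ℂ).im := by rw [hw]
  simp only [sq, mul_re, mul_im, ratCast_re, ratCast_im] at hre him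
  have hδR : (δ : ℝ) < 0 := by exact_mod_cast hδ
  have hre0 : w.re = 0 := by
    by_contra h
    have him0 : w.im = 0 := by
      have : 2 * (w.re * w.im) = 0 := by linarith
      rcases mul_eq_zero.mp this with h2 | h2
      · norm_num at h2
      · exact (mul_eq_zero.mp h2).resolve_left h
    rw [him0] at hre
    nlinarith [sq_nonneg w.re]
  apply Complex.ext
  · simp [hre0]
  · simp

end Summit.BirchSwinnertonDyer.BirchSwinnertonDyer.Theorems.ManinLocalTwoThree.ComplexAut

end
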